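import Summits.CriticalPhenomena.PercolationContinuityZ3.Theorems.PercNearOneGluingNoHeavyLowerTailSahiGridPatternLiteralTwoGood
import Summits.CriticalPhenomena.PercolationContinuityZ3.Theorems.PercNearOneGluingNoHeavyLowerTailSahiGridPatternLiteralAndGood
import Summits.CriticalPhenomena.PercolationContinuityZ3.Theorems.PercNearOneGluingNoHeavyLowerTailSahiGridPatternStarCertPrelim

/-!
# `NoHeavyLowerTail` (crux stmt-CriticalPhenomena-4575), Sahi programme P1: **THE FOUR ONE-AXIS LITERAL STEPS PRESERVE GOODNESS** —
# uniform closure lemmas for the caterpillar read-once theorem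

Support file (Sahi cell, seat `prim-sahi-p1`, generation 25; `--supports stmt-CriticalPhenomena-4575`).  Pure proofs, no definitions, no `sorry`.
For an up-set `U' ⊆ [3]^k` that is GOOD (`0 ≤ sStarD U' P R` for all up-sets `P, R`) and a literal `[t ≤ ξ]`, `t ∈ {1,2}`, on a new first axis, the glued sets
`A_∨ = {(ξ,z) : t ≤ ξ ∨ z ∈ U'}` and `A_∧ = {(ξ,z) : t ≤ ξ ∧ z ∈ U'}` are good up-sets of `[3]^{1+k}` (`sStarD_nonneg_literalOr_of_good`,
`sStarD_nonneg_literalAnd_of_good`, from `litOneAbsorb_cert`, `sStarD_literalTwo_nonneg_of_good` (T1), `sStarD_literalOne/Two_inter_nonneg_of_good` (T2', T2)).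
Iterating from the seeds `univ`/`∅ ⊆ [3]^m` (good: `sStarD_principal_nonneg` with threshold 0, `sStarD_empty_left`) gives: every CATERPILLAR read-once pattern
(one literal axis added at a time by ∧/∨, free block innermost) is a good first slot in every dimension. [this work]
-/

namespace Summit.CriticalPhenomena.PercolationContinuityZ3.Theorems.SahiGridPattern

open Finset SahiGrid3
open scoped BigOperators

variable {k : ℕ}

/-- The ∨-glued set `{(ξ,z) : t ≤ ξ ∨ z ∈ U'}` is an up-set. [this work] -/
theorem isUpperSet_of_mem_glue_or (t : Fin 3) {U' : Finset (Pd k)} (hU' : IsUpperSet (U' : Set (Pd k))) {A : Finset (Pd (1 + k))}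
    (hA : ∀ ξ z, glue ξ z ∈ A ↔ t ≤ ξ 0 ∨ z ∈ U') : IsUpperSet (A : Set (Pd (1 + k))) := by
  intro x y hxy hx
  rw [Finset.mem_coe, ← glue_freeOf_cellOf x, hA] at hx
  rw [Finset.mem_coe, ← glue_freeOf_cellOf y, hA]
  rw [← glue_freeOf_cellOf x, ← glue_freeOf_cellOf y, glue_le_glue_iff] at hxy
  rcases hx with h | h
  · exact Or.inl (le_trans h (hxy.1 0))
  · exact Or.inr (hU' hxy.2 h)

/-- The ∧-glued set `{(ξ,z) : t ≤ ξ ∧ z ∈ U'}` is an up-set. [this work] -/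
theorem isUpperSet_of_mem_glue_and (t : Fin 3) {U' : Finset (Pd k)} (hU' : IsUpperSet (U' : Set (Pd k))) {A : Finset (Pd (1 + k))}
    (hA : ∀ ξ z, glue ξ z ∈ A ↔ t ≤ ξ 0 ∧ z ∈ U') : IsUpperSet (A : Set (Pd (1 + k))) := by
  intro x y hxy hx
  rw [Finset.mem_coe, ← glue_freeOf_cellOf x, hA] at hx
  rw [Finset.mem_coe, ← glue_freeOf_cellOf y, hA]
  rw [← glue_freeOf_cellOf x, ← glue_freeOf_cellOf y, glue_le_glue_iff] at hxy
  exact ⟨le_trans hx.1 (hxy.1 0), hU' hxy.2 hx.2⟩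

/-- **∨-STEP**: a literal `[t ≤ ξ]` (`t ≠ 0`) OR a good set is good. [this work] -/
theorem sStarD_nonneg_literalOr_of_good (t : Fin 3) (ht : t ≠ 0) {U' : Finset (Pd k)} (hU' : IsUpperSet (U' : Set (Pd k)))
    (hgood : ∀ P R : Finset (Pd k), IsUpperSet (P : Set (Pd k)) → IsUpperSet (R : Set (Pd k)) → 0 ≤ sStarD U' P R)
    {A : Finset (Pd (1 + k))} (hA : ∀ ξ z, glue ξ z ∈ A ↔ t ≤ ξ 0 ∨ z ∈ U')
    (B C : Finset (Pd (1 + k))) (hB : IsUpperSet (B : Set (Pd (1 + k)))) (hC : IsUpperSet (C : Set (Pd (1 + k)))) :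
    0 ≤ sStarD A B C := by
  classical
  set ℓ : Pd 1 := fun _ => t with hℓ
  set X : Finset (Pd (1 + k)) := univ.filter fun y : Pd (1 + k) => ∀ j, ℓ j ≤ freeOf y j with hXd
  set Y : Finset (Pd (1 + k)) := univ.filter fun y : Pd (1 + k) => cellOf y ∈ U' with hYd
  have hX : ∀ (ξ : Pd 1) (z : Pd k), glue ξ z ∈ X ↔ ξ ∈ (univ.filter fun y : Pd 1 => ∀ j, ℓ j ≤ y j) := by
    intro ξ z; rw [hXd, Finset.mem_filter, Finset.mem_filter, freeOf_glue]; simp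
  have hY : ∀ (ξ : Pd 1) (z : Pd k), glue ξ z ∈ Y ↔ z ∈ U' := by
    intro ξ z; rw [hYd, Finset.mem_filter, cellOf_glue]; simp
  have hAXY : A = X ∪ Y := by
    ext y
    rw [← glue_freeOf_cellOf y, hA, Finset.mem_union, hX, hY, Finset.mem_filter]
    simp only [Finset.mem_univ, true_and, Fin.forall_fin_one, hℓ]
  rw [hAXY]
  have ht12 : t = 1 ∨ t = 2 := by
    have : ∀ u : Fin 3, u ≠ 0 → u = 1 ∨ u = 2 := by decide
    exact this t ht
  rcases ht12 with h1 | h2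
  · have hℓ1 : ∀ i, ℓ i = 1 := fun _ => by rw [hℓ]; exact h1
    obtain ⟨_, hT, hN⟩ := litOneAbsorb_cert ℓ hℓ1 hU' hX hY
    exact sStarD_nonneg_of_diagCert _ _ hT hN hB hC
  · have hℓ2 : ℓ 0 = 2 := by rw [hℓ]; exact h2
    exact sStarD_literalTwo_nonneg_of_good ℓ hℓ2 hU' hgood hX hY B C hB hC

/-- **∧-STEP**: a literal `[t ≤ ξ]` (`t ≠ 0`) AND a good set is good. [this work] -/
theorem sStarD_nonneg_literalAnd_of_good (t : Fin 3) (ht : t ≠ 0) {U' : Finset (Pd k)} (hU' : IsUpperSet (U' : Set (Pd k)))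
    (hgood : ∀ P R : Finset (Pd k), IsUpperSet (P : Set (Pd k)) → IsUpperSet (R : Set (Pd k)) → 0 ≤ sStarD U' P R)
    {A : Finset (Pd (1 + k))} (hA : ∀ ξ z, glue ξ z ∈ A ↔ t ≤ ξ 0 ∧ z ∈ U')
    (B C : Finset (Pd (1 + k))) (hB : IsUpperSet (B : Set (Pd (1 + k)))) (hC : IsUpperSet (C : Set (Pd (1 + k)))) :
    0 ≤ sStarD A B C := by
  classical
  have hind : ∀ (i : Fin 3) (z : Pd k), ind A (glue (fun _ => i : Pd 1) z) = if t ≤ i then ind U' z else 0 := by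
    intro i z
    unfold ind
    by_cases hi : t ≤ i
    · rw [if_pos hi]
      by_cases hz : z ∈ U'
      · rw [if_pos ((hA _ z).2 ⟨hi, hz⟩), if_pos hz]
      · rw [if_neg (fun h => hz ((hA _ z).1 h).2), if_neg hz]
    · rw [if_neg hi, if_neg (fun h => hi ((hA _ z).1 h).1)]
  have ht12 : t = 1 ∨ t = 2 := by
    have : ∀ u : Fin 3, u ≠ 0 → u = 1 ∨ u = 2 := by decide
    exact this t ht
  rcases ht12 with rfl | rfl
  · have hA0 : ∀ z, ind A (glue (fun _ => 0) z) = 0 := fun z => by rw [hind]; exact if_neg (by decide)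
    have hA1 : ∀ z, ind A (glue (fun _ => 1) z) = ind U' z := fun z => by rw [hind]; exact if_pos (by decide)
    have hA2 : ∀ z, ind A (glue (fun _ => 2) z) = ind U' z := fun z => by rw [hind]; exact if_pos (by decide)
    exact sStarD_literalOne_inter_nonneg_of_good hU' hgood hA0 hA1 hA2 B C hB hC
  · have hA0 : ∀ z, ind A (glue (fun _ => 0) z) = 0 := fun z => by rw [hind]; exact if_neg (by decide)
    have hA1 : ∀ z, ind A (glue (fun _ => 1) z) = 0 := fun z => by rw [hind]; exact if_neg (by decide)
    have hA2 : ∀ z, ind A (glue (fun _ => 2) z) = ind U' z := fun z => by rw [hind]; exact if_pos (by decide)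
    exact sStarD_literalTwo_inter_nonneg_of_good hU' hgood hA0 hA1 hA2 B C hB hC

/-- **SEED ⊤**: the whole cube `[3]^m` is good. [this work] -/
theorem sStarD_univ_nonneg' {m : ℕ} (B C : Finset (Pd m)) (hB : IsUpperSet (B : Set (Pd m))) (hC : IsUpperSet (C : Set (Pd m))) :
    0 ≤ sStarD (univ : Finset (Pd m)) B C := by
  have e : (univ : Finset (Pd m)) = univ.filter fun x : Pd m => ∀ a, (fun _ => (0 : Fin 3)) a ≤ x a := by
    ext x; simp
  rw [e]; exact sStarD_principal_nonneg m _ B C hB hC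

/-- **SEED ∅**: the empty pattern is good (`sStarD ∅ B C = 0`). [this work] -/
theorem sStarD_empty_nonneg' {m : ℕ} (B C : Finset (Pd m)) : 0 ≤ sStarD (∅ : Finset (Pd m)) B C := by
  rw [sStarD_empty_left]

end Summit.CriticalPhenomena.PercolationContinuityZ3.Theorems.SahiGridPattern
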